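import Literature.MathematicalPhysics.QuantumFieldTheory.Balaban1983to89.B3Sect3DivergentClasses

/-!
# `Balaban1983to89.B3Sect2ThreeLegTwoVertex` — T. Bałaban, *(Higgs)₂,₃ quantum fields in a finite volume. III. Renormalization*,
Commun. Math. Phys. **88** (1983) 411–445 [Balaban1983Higgs3]: p. 430 *"In fact the only other divergent graphs of this class are:
(2.21)"* (class = two external scalar legs and one external vector leg) — the TWO-VERTEX graphs of the class DECIDED on the concrete
family `B3Cor23Concrete.Graph` (d = 3), at the level of vertices, incidences and tadpoles

statement-level skeleton of published theorems with citation tags; proofs where landed; nothing here is a claim about the Yang–Mills mass gap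

PDF held: `paper:balaban1983-higgs-2-3-quantum-fields-finite-volume` (journal page = PDF page + 410); displays (2.18)–(2.21) read as
images (strip crops): `…/b2b-balaban-ref1/pages/1983-cmp88-higgs23-III/1983-cmp88-higgs23-III-p019, p020-x2.png` (pp. 429, 430).
CITATION HEADER (lean-in-tree rule).  lit-balaban TYPED SKELETON (HOME `run/shared/lean/pub/lit-balaban/`), Phase 2, seat p18 (gen 3),
unit `lit-balaban-p18`; SKELETON row **B3.Eq2.18-2.22** (fold owner r15) and the reading note HOME/GAPS.md **G-B3-03** (seat p18 gen 2:
the class has two more members X1, X2 on the model — until now a mechanical (python) enumeration).  Inputs: the vertex content of the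
class `B3Sect3DivergentClasses.threeLeg_structure` (p248510), the degree formula `B3Sect3DegreeCensus` (p248239); the pictures as
model graphs: `B3Sect2ThreeLegGraphs` (p248628).  Sibling: `…B3Sect2ThreeLegThreeVertex` (three vertices + the case split).

WHAT THIS MODULE PROVES (d = 3, n̄ ≥ 2; sorry-free; one `def` with body: `SelfLine G i` = «a line of G with both endpoints at the
vertex i»; no `Prop` fact).  For a graph of the model with D(G) ≤ 0, two external φ′-legs and one external vector leg (A′ or Ã):
`threeLeg_twoVertices` — if it has two vertices and no vertex (1.6), its (kinds; internal φ′-legs; internal A′-legs) are those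
of **(2.18)** ((1.8)_{1,0} & (1.8)_{1,1}∕(1.8)_{2,0}; 1,1; 1,1), **(2.19)** ((1.8)_{1,0} & (1.10)_{1,1}∕(1.10)_{2,0}; 1,1; 1,1),
**(2.21a)** (same kinds; 2,0; 1,1), **(2.21e)** ((1.8)_{0,1}∕(1.8)_{1,0} & (1.8)_{2,0}; 1,1; 0,2), **(2.21d)** ((1.8)_{0,1}∕(1.8)_{1,0} &
(1.10)_{2,0}; 1,1; 0,2) or ONE disconnected configuration (φ′-tadpole at (1.8) next to the A′-tadpole at (1.10)_{2,0}; 2,0; 0,2 — the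
model does not impose connectedness), every differentiation internal; `threeLeg_twoVertices_phi4` — if one vertex is (1.6), the other
is (1.8) with n + n′ = 1 and the φ′-legs realize **(2.21f)** (1 and 3 internal), **X1** (2 and 2, no tadpole at the (1.8)-vertex) or
the disconnected pair of tadpoles.  With two vertices these incidence data determine the pairing of legs up to the symmetries of the
vertices, i.e. the pictures; the second member of each «∕» is the same picture with an uncontracted A′-leg as the external vector leg
(*"permuted graphs"*).  `other_inj`: «the other endpoint» is injective.  NOT here: 1PI; the analytic content of the class (Sect. 3).
-/

namespace Literature.MathematicalPhysics.QuantumFieldTheory.Balaban1983to89.B3Sect2ThreeLegTwoVertex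

open Finset B3Prop1 B3Sect2Statements B3VertexBridge B3Cor23Concrete B3DivergentGraphs B3ScalarLegParity B3OddVectorLoops
  B3Sect3DegreeCensus B3Sect3DivergentClasses

variable {nbar : ℕ} (G : Graph nbar)

/-- kernel: «the other endpoint» is injective on internal legs (it is a fixed-point-free involution, p. 415).
[cite: Balaban1983Higgs3, p.415] -/
theorem other_inj {x x' y : Leg G.kind} (h : G.other x = some y) (h' : G.other x' = some y) : x = x' := by
  have h1 := G.other_symm _ _ h
  have h2 := G.other_symm _ _ h'
  rw [h1] at h2
  exact Option.some_injective _ h2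

/-- «G has a line with both endpoints at the vertex i» (a tadpole at i). [cite: Balaban1983Higgs3, p.415] -/
def SelfLine (i : Fin G.nV) : Prop := ∃ x y : Leg G.kind, x.1 = i ∧ G.other x = some y ∧ y.1 = i

/-- The two-vertex divergent graphs with two external scalar legs and one external vector leg, d = 3, n̄ ≥ 2 — DECIDED on the
model at the level of vertices and incidences: with X = 0 (every differentiation internal) they are (2.18), (2.19), (2.21a),
(2.21d), (2.21e) (p. 430: *"the only other divergent graphs of this class are (2.21)"*, two-vertex members) and one disconnected
configuration (the φ′-tadpole at a vertex (1.8) with n + n′ = 1 next to the A′-tadpole at (1.10)_{2,0}; the model does not impose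
connectedness).  The external vector leg is the Ã-leg of a vertex with n′ = 1 or the uncontracted A′-leg of a vertex with one
more A′-leg (both readings listed). [cite: Balaban1983Higgs3, (2.21) p.430] -/
theorem threeLeg_twoVertices (hn : 2 ≤ nbar) (hD : G.deg 3 ≤ 0) (hs : numExtScalarLegs G = 2)
    (hv : numExtVectorLegs G + numTildeLegs G = 1) (hV : G.nV = 2) (h16 : numV16 G = 0) :
    ∃ i j : Fin G.nV, i ≠ j ∧ G.intDiffs i = (G.kind i).diffCount ∧ G.intDiffs j = (G.kind j).diffCount ∧
      ( -- (2.18)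
        (G.kind i = .v18 1 0 ∧ (G.kind j = .v18 1 1 ∨ G.kind j = .v18 2 0) ∧
          G.intScalar i = 1 ∧ G.intScalar j = 1 ∧ G.intVector i = 1 ∧ G.intVector j = 1) ∨
        -- (2.19)
        (G.kind i = .v18 1 0 ∧ (G.kind j = .v110 1 1 ∨ G.kind j = .v110 2 0) ∧
          G.intScalar i = 1 ∧ G.intScalar j = 1 ∧ G.intVector i = 1 ∧ G.intVector j = 1) ∨
        -- (2.21a)
        (G.kind i = .v18 1 0 ∧ (G.kind j = .v110 1 1 ∨ G.kind j = .v110 2 0) ∧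
          G.intScalar i = 2 ∧ G.intScalar j = 0 ∧ G.intVector i = 1 ∧ G.intVector j = 1) ∨
        -- (2.21e)
        ((G.kind i = .v18 0 1 ∨ G.kind i = .v18 1 0) ∧ G.kind j = .v18 2 0 ∧
          G.intScalar i = 1 ∧ G.intScalar j = 1 ∧ G.intVector i = 0 ∧ G.intVector j = 2) ∨
        -- (2.21d)
        ((G.kind i = .v18 0 1 ∨ G.kind i = .v18 1 0) ∧ G.kind j = .v110 2 0 ∧
          G.intScalar i = 1 ∧ G.intScalar j = 1 ∧ G.intVector i = 0 ∧ G.intVector j = 2) ∨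
        -- disconnected: φ′-tadpole at i, A′-tadpole at j
        ((G.kind i = .v18 0 1 ∨ G.kind i = .v18 1 0) ∧ G.kind j = .v110 2 0 ∧
          G.intScalar i = 2 ∧ G.intScalar j = 0 ∧ G.intVector i = 0 ∧ G.intVector j = 2)) := by
  have hG := not_hasVertex1315_of_deg_nonpos G hD
  obtain ⟨h17, hX, hbr⟩ := threeLeg_structure G hD hs hv
  have hiv : numIntVectorLegs G = 2 := by rcases hbr with ⟨h, -, -, -⟩ | ⟨-, h, -⟩ <;> omega
  have hsc := two_nV_add_eq G hG
  have heo := eOrder_eq G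
  have hvl := sum_vectorLegs_eq G
  obtain ⟨i₀, i₁, hne, hall, hsum⟩ := two_vertices G hV
  have hS := hsum G.intScalar
  have hIV : numIntVectorLegs G = G.intVector i₀ + G.intVector i₁ := hsum G.intVector
  have hVL := hsum fun j => (G.kind j).vectorLegs
  have hDV := hsum fun j => (G.kind j).dv
  rw [← eOrder] at hDV
  have hdiff : ∀ i, G.intDiffs i = (G.kind i).diffCount := fun i => by
    have := (sum_eq_zero_iff.mp hX) i (mem_univ i); have := G.intDiffs_le i; omega
  have hkinds : ∀ i, (∃ n n', 1 ≤ n + n' ∧ G.kind i = .v18 n n') ∨ (∃ n n', 2 ≤ n + n' ∧ G.kind i = .v110 n n') :=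
    fun i => kind_cases_tilde_le_two hn (G.kind i) (G.adm i) (isOfForm1315_eq_false G hG i) (kind_ne_v16 G h16 i)
      (kind_ne_v17 G h17 i) ((extVectorLegs_le G i).trans (by omega))
  have hivle : ∀ i, G.intVector i ≤ (G.kind i).vectorLegs := fun i => G.intVector_le i
  have hisle : ∀ i, G.intScalar i ≤ (G.kind i).scalarLegs := fun i => G.intScalar_le i
  have hdile : ∀ i, G.intDiffs i ≤ G.intScalar i := fun i => B3Cor23ConcreteTwoDim.intDiffs_le_intScalar G i
  have htle : ∀ i, (G.kind i).extVectorLegs ≤ numTildeLegs G := fun i => extVectorLegs_le G i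
  -- per-vertex numeric data
  have key : ∀ i j : Fin G.nV, i ≠ j → (∀ k, k = i ∨ k = j) →
      G.intScalar i + G.intScalar j = 2 → G.intVector i + G.intVector j = 2 →
      (G.kind i).vectorLegs + (G.kind j).vectorLegs = 2 + numExtVectorLegs G →
      (G.kind i).dv + (G.kind j).dv = 3 → (G.kind i).dv ≤ (G.kind j).dv →
      ( (G.kind i = .v18 1 0 ∧ (G.kind j = .v18 1 1 ∨ G.kind j = .v18 2 0) ∧
          G.intScalar i = 1 ∧ G.intScalar j = 1 ∧ G.intVector i = 1 ∧ G.intVector j = 1) ∨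
        (G.kind i = .v18 1 0 ∧ (G.kind j = .v110 1 1 ∨ G.kind j = .v110 2 0) ∧
          G.intScalar i = 1 ∧ G.intScalar j = 1 ∧ G.intVector i = 1 ∧ G.intVector j = 1) ∨
        (G.kind i = .v18 1 0 ∧ (G.kind j = .v110 1 1 ∨ G.kind j = .v110 2 0) ∧
          G.intScalar i = 2 ∧ G.intScalar j = 0 ∧ G.intVector i = 1 ∧ G.intVector j = 1) ∨
        ((G.kind i = .v18 0 1 ∨ G.kind i = .v18 1 0) ∧ G.kind j = .v18 2 0 ∧
          G.intScalar i = 1 ∧ G.intScalar j = 1 ∧ G.intVector i = 0 ∧ G.intVector j = 2) ∨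
        ((G.kind i = .v18 0 1 ∨ G.kind i = .v18 1 0) ∧ G.kind j = .v110 2 0 ∧
          G.intScalar i = 1 ∧ G.intScalar j = 1 ∧ G.intVector i = 0 ∧ G.intVector j = 2) ∨
        ((G.kind i = .v18 0 1 ∨ G.kind i = .v18 1 0) ∧ G.kind j = .v110 2 0 ∧
          G.intScalar i = 2 ∧ G.intScalar j = 0 ∧ G.intVector i = 0 ∧ G.intVector j = 2)) := by
    intro i j hij _ hSij hIVij hVLij hDVij hle
    have hdi := hdiff i; have hdj := hdiff j
    have h1 := hivle i; have h2 := hivle j; have h3 := hisle i; have h4 := hisle j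
    have h5 := hdile i; have h6 := hdile j; have h7 := htle i; have h8 := htle j
    rcases hkinds i with ⟨n, t, hnt, hki⟩ | ⟨n, t, hnt, hki⟩ <;>
      rcases hkinds j with ⟨m, s, hms, hkj⟩ | ⟨m, s, hms, hkj⟩ <;>
      rw [hki] at hdi h1 h3 h7 hVLij hDVij hle ⊢ <;> rw [hkj] at hdj h2 h4 h8 hVLij hDVij hle ⊢ <;>
      simp only [VertexKind.vectorLegs, VertexKind.scalarLegs, VertexKind.diffCount, VertexKind.dv,
        VertexKind.extVectorLegs] at hdi hdj h1 h2 h3 h4 h7 h8 hVLij hDVij hle ⊢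
    -- (v18 n t, v18 m s): n + t = 1, m + s = 2
    · have hnt1 : n + t = 1 := by omega
      rcases Nat.lt_or_ge (G.intVector i) 1 with hi0 | hi1
      · -- the A′-tadpole at j = (1.8)_{2,0}: (2.21e)
        have hm : m = 2 := by omega
        have hs0 : s = 0 := by omega
        subst hm; subst hs0
        right; right; right; left
        refine ⟨?_, rfl, by omega, by omega, by omega, by omega⟩
        rcases Nat.lt_or_ge n 1 with hn0 | hn1'
        · left; have : n = 0 := by omega
          subst this; have : t = 1 := by omega
          subst this; rfl
        · right; have : n = 1 := by omega
          subst this; have : t = 0 := by omega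
          subst this; rfl
      · -- the A′-line joins i and j: (2.18)
        have hn1 : n = 1 := by omega
        have ht0 : t = 0 := by omega
        subst hn1; subst ht0
        left
        refine ⟨rfl, ?_, by omega, by omega, by omega, by omega⟩
        rcases Nat.lt_or_ge s 1 with hs0 | hs1
        · right; have : s = 0 := by omega
          subst this; have : m = 2 := by omega
          subst this; rfl
        · left; have : s = 1 := by omega
          subst this; have : m = 1 := by omega
          subst this; rfl
    -- (v18 n t, v110 m s): n + t = 1, m + s = 2
    · have hnt1 : n + t = 1 := by omega
      rcases Nat.lt_or_ge (G.intVector i) 1 with hi0 | hi1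
      · -- the A′-tadpole at j = (1.10)_{2,0}: (2.21d) or the disconnected configuration
        have hm : m = 2 := by omega
        have hs0 : s = 0 := by omega
        subst hm; subst hs0
        have hki' : VertexKind.v18 n t = .v18 0 1 ∨ VertexKind.v18 n t = .v18 1 0 := by
          rcases Nat.lt_or_ge n 1 with hn0 | hn1'
          · left; have : n = 0 := by omega
            subst this; have : t = 1 := by omega
            subst this; rfl
          · right; have : n = 1 := by omega
            subst this; have : t = 0 := by omega
            subst this; rfl
        rcases Nat.lt_or_ge (G.intScalar i) 2 with hlt | hge
        · right; right; right; right; left; exact ⟨hki', rfl, by omega, by omega, by omega, by omega⟩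
        · right; right; right; right; right; exact ⟨hki', rfl, by omega, by omega, by omega, by omega⟩
      · -- the A′-line joins i and j: (2.19) or (2.21a)
        have hn1 : n = 1 := by omega
        have ht0 : t = 0 := by omega
        subst hn1; subst ht0
        have hkj' : VertexKind.v110 m s = .v110 1 1 ∨ VertexKind.v110 m s = .v110 2 0 := by
          rcases Nat.lt_or_ge s 1 with hs0 | hs1
          · right; have : s = 0 := by omega
            subst this; have : m = 2 := by omega
            subst this; rfl
          · left; have : s = 1 := by omega
            subst this; have : m = 1 := by omega
            subst this; rfl
        rcases Nat.lt_or_ge (G.intScalar i) 2 with hlt | hge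
        · right; left; exact ⟨rfl, hkj', by omega, by omega, by omega, by omega⟩
        · right; right; left; exact ⟨rfl, hkj', by omega, by omega, by omega, by omega⟩
    -- (v110, v18) with dv i ≤ dv j: impossible
    · omega
    -- (v110, v110): impossible
    · omega
  have hS2 : G.intScalar i₀ + G.intScalar i₁ = 2 := by omega
  have hIV2 : G.intVector i₀ + G.intVector i₁ = 2 := by omega
  have hVL2 : (G.kind i₀).vectorLegs + (G.kind i₁).vectorLegs = 2 + numExtVectorLegs G := by omega
  have hDV3 : (G.kind i₀).dv + (G.kind i₁).dv = 3 := by omega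
  rcases Nat.le_total ((G.kind i₀).dv) ((G.kind i₁).dv) with hle | hle
  · exact ⟨i₀, i₁, hne, hdiff i₀, hdiff i₁, key i₀ i₁ hne hall hS2 hIV2 hVL2 hDV3 hle⟩
  · exact ⟨i₁, i₀, hne.symm, hdiff i₁, hdiff i₀,
      key i₁ i₀ hne.symm (fun k => (hall k).symm) (by omega) (by omega) (by omega) (by omega) hle⟩

/-- The two-vertex divergent graphs of the class containing the vertex (1.6), d = 3, n̄ ≥ 2 — DECIDED on the model: the other vertex
is (1.8) with n + n′ = 1 (no internal A′-leg, its differentiation internal), and the φ′-lines realize (2.21f) (one leg of (1.8) and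
three legs of (1.6) internal: the line between them and the tadpole at (1.6)), X1 of HOME/GAPS.md G-B3-03 (both legs of (1.8) joined
to (1.6)), or the disconnected pair of φ′-tadpoles. [cite: Balaban1983Higgs3, (2.21) p.430] -/
theorem threeLeg_twoVertices_phi4 (hn : 2 ≤ nbar) (hD : G.deg 3 ≤ 0) (hs : numExtScalarLegs G = 2)
    (hv : numExtVectorLegs G + numTildeLegs G = 1) (h16 : numV16 G = 1) :
    ∃ i j : Fin G.nV, i ≠ j ∧ G.nV = 2 ∧ (G.kind i = .v18 0 1 ∨ G.kind i = .v18 1 0) ∧ G.kind j = .v16 ∧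
      G.intDiffs i = 1 ∧ G.intVector i = 0 ∧
      ( -- (2.21f)
        (G.intScalar i = 1 ∧ G.intScalar j = 3) ∨
        -- X1
        (G.intScalar i = 2 ∧ G.intScalar j = 2 ∧ ¬ SelfLine G i) ∨
        -- disconnected: two φ′-tadpoles
        (G.intScalar i = 2 ∧ G.intScalar j = 2 ∧ SelfLine G i)) := by
  have hG := not_hasVertex1315_of_deg_nonpos G hD
  obtain ⟨h17, hX, hbr⟩ := threeLeg_structure G hD hs hv
  obtain ⟨hiv, -, hV⟩ : numIntVectorLegs G = 0 ∧ numV16 G = 1 ∧ G.nV = 2 := by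
    rcases hbr with ⟨-, h, -, -⟩ | h
    · omega
    · exact h
  have hsc := two_nV_add_eq G hG
  have heo := eOrder_eq G
  obtain ⟨i₀, i₁, hne, hall, hsum⟩ := two_vertices G hV
  have hS := hsum G.intScalar
  have hIV : numIntVectorLegs G = G.intVector i₀ + G.intVector i₁ := hsum G.intVector
  have hDV := hsum fun j => (G.kind j).dv
  rw [← eOrder] at hDV
  have h16s := hsum fun j => if G.kind j = .v16 then 1 else 0
  rw [← numV16_eq_sum, h16] at h16s
  have hdiff : ∀ i, G.intDiffs i = (G.kind i).diffCount := fun i => by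
    have := (sum_eq_zero_iff.mp hX) i (mem_univ i); have := G.intDiffs_le i; omega
  -- the vertex which is not (1.6)
  have key : ∀ i j : Fin G.nV, i ≠ j → G.kind j = .v16 → G.kind i ≠ .v16 →
      G.intScalar i + G.intScalar j = 4 → G.intVector i + G.intVector j = 0 → (G.kind i).dv + (G.kind j).dv = 1 →
      (G.kind i = .v18 0 1 ∨ G.kind i = .v18 1 0) ∧ G.kind j = .v16 ∧ G.intDiffs i = 1 ∧ G.intVector i = 0 ∧
      ((G.intScalar i = 1 ∧ G.intScalar j = 3) ∨ (G.intScalar i = 2 ∧ G.intScalar j = 2 ∧ ¬ SelfLine G i) ∨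
        (G.intScalar i = 2 ∧ G.intScalar j = 2 ∧ SelfLine G i)) := by
    intro i j hij hkj hki hSij hIVij hDVij
    have hdi := hdiff i
    have h3 := G.intScalar_le i
    have h5 := B3Cor23ConcreteTwoDim.intDiffs_le_intScalar G i
    rw [hkj, show VertexKind.v16.dv = 0 from rfl] at hDVij
    rcases kind_cases_tilde_le_two hn (G.kind i) (G.adm i) (isOfForm1315_eq_false G hG i) hki (kind_ne_v17 G h17 i)
        ((extVectorLegs_le G i).trans (by omega)) with ⟨n, t, hnt, hk⟩ | ⟨n, t, hnt, hk⟩ <;>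
      rw [hk] at hdi h3 hDVij ⊢ <;>
      simp only [VertexKind.scalarLegs, VertexKind.diffCount, VertexKind.dv] at hdi h3 hDVij ⊢
    · have hki' : VertexKind.v18 n t = .v18 0 1 ∨ VertexKind.v18 n t = .v18 1 0 := by
        rcases Nat.lt_or_ge n 1 with hn0 | hn1'
        · left; have : n = 0 := by omega
          subst this; have : t = 1 := by omega
          subst this; rfl
        · right; have : n = 1 := by omega
          subst this; have : t = 0 := by omega
          subst this; rfl
      refine ⟨hki', hkj, hdi, by omega, ?_⟩
      rcases Nat.lt_or_ge (G.intScalar i) 2 with hlt | hge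
      · left; omega
      · right
        by_cases hself : SelfLine G i
        · right; exact ⟨by omega, by omega, hself⟩
        · left; exact ⟨by omega, by omega, hself⟩
    · omega
  have hS4 : G.intScalar i₀ + G.intScalar i₁ = 4 := by omega
  have hIV0 : G.intVector i₀ + G.intVector i₁ = 0 := by omega
  have hDV1 : (G.kind i₀).dv + (G.kind i₁).dv = 1 := by omega
  by_cases hk0 : G.kind i₀ = .v16
  · have hk1 : G.kind i₁ ≠ .v16 := fun h => by simp [hk0, h] at h16s
    obtain ⟨a, b, c, d, e⟩ := key i₁ i₀ hne.symm hk0 hk1 (by omega) (by omega) (by omega)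
    exact ⟨i₁, i₀, hne.symm, hV, a, b, c, d, e⟩
  · have hk1 : G.kind i₁ = .v16 := by by_contra h; simp [hk0, h] at h16s
    obtain ⟨a, b, c, d, e⟩ := key i₀ i₁ hne hk1 hk0 hS4 hIV0 hDV1
    exact ⟨i₀, i₁, hne, hV, a, b, c, d, e⟩

end Literature.MathematicalPhysics.QuantumFieldTheory.Balaban1983to89.B3Sect2ThreeLegTwoVertex
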